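import Summits.NavierStokesRegularity.NavierStokesRegularity.Theorems.SqueezeCycleExtremalBiaxialitySubcriticalGaugeStrainBound
import Literature.Analysis.FluidPDE.DivCurlAnnihilator
import Literature.Analysis.FluidPDE.LeraySelfSimilarCalculus
import Mathlib.Analysis.Calculus.BumpFunction.FiniteDimension
import HarnessLib

/-!
# Crux `ExtremalBiaxialitySubcritical` (stmt-NavierStokesRegularity-11609), negative side:
# the kinematic decoy — the Oseen identity is the only load-bearing clause against kinematics

Route `SqueezeCycle`, crux
`Summit.NavierStokesRegularity.NavierStokesRegularity.Theses.SqueezeCycle.ExtremalBiaxialitySubcritical`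
("if `u ∈ 𝒦_C` attains at `(t₀,x₀)`, `t₀ < 0`, a Leray-gauge middle strain eigenvalue `≥ m` which is
maximal over the Type-I model class `𝒦_C`, then `m < 1/8`"). Extracted from the crux work file
`Cruxes/ExtremalBiaxialitySubcritical/Disproof.lean` (cdisprove adversary, generation 4, D-0016).

The class `𝒦_C` has five clauses: (H1) joint smoothness on `t < 0`, (H2) `div u(t) = 0`,
(H3) the KNSS/Oseen mild identity between every pair of times `s < t < 0`, (H4) the Type-I rate
`‖u(t,x)‖ ≤ C/√(−t)`, (H5) scaled local energies `≤ C` in every backward parabolic cylinder with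
top `t₀ ≤ 0`. By `Negative/MaximalityFree` the crux is the a-priori bound "`Λ < 1/8` at every
point of every element of every `𝒦_C`". This file certifies that the bound is carried ENTIRELY by
the dynamics (H3):

* `decoy a δ` — the **kinematic decoy** `u(t, x) = φ(t)·a·W(x/δ)`, `W = (∂₀g)e₁ − (∂₁g)e₀` the
  curl-type field (tree `isDivFree_curlPair_of_contDiff`) of `g = ψ·(x₀x₁ − 2x₁x₂)`, `ψ` a bump
  `≡ 1` on the unit ball, `φ` a bump in time `≡ 1` near `t = −1` supported in `(−3/2, −1/2)` — is
  smooth, divergence free, compactly supported in space-time, and near the origin at `t = −1`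
  equals the linear field `a δ⁻¹ (−x₀ + 2x₂, x₁, 0)` whose strain has the quadratic form
  `≥ (a/2δ)|·|²` on the orthonormal frame `(e₁, (e₀+e₂)/√2)` (`decoy_lamGE`).
* `exists_kinematic_decoy` — for EVERY constant `C > 0` and EVERY value `m`, some decoy satisfies
  (H1), (H2), (H4) AND (H5) with that constant `C` and attains the crux's lower two-frame clause
  with value `m` at `(−1, 0)`: the kinematic part of `𝒦_C` (everything except the Oseen identity)
  does not bound the Leray-gauge middle strain eigenvalue at all, at any positive Type-I constant —
  while on `𝒦_C` itself it is bounded by `K₀(C)` (KNSS gradient bound, tree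
  `exists_gauge_norm_fderiv_le_of_typeI`) and vanishes identically for `C ≤ ε`
  (`squeezeClass_eq_zero_of_small`).
* `false_without_oseen` — consequently the crux with the extremal element's membership weakened
  to its kinematic part (H1 ∧ H2 ∧ H4 ∧ H5, the Oseen identity H3 dropped), the attainment clause
  and the GENUINE class-maximality over `𝒦_C` kept verbatim, is FALSE at every `C > 0` (the
  class-maximal value `m = max(K₀(C), 1/8)` is attained by a decoy; the statement is spelled
  inline, clause by clause); at `C = 0` it is true (`withoutOseen_zero`, the slice vanishes). Compare `Negative/ExactStrainFlows`: there membership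
  is replaced by "exact Navier–Stokes flow" and the witnesses violate (H4); here (H4) and (H5) are
  kept and only (H3) is dropped. Each of H3 and H4 is therefore load-bearing on its own; whether
  H5 is (i.e. whether the crux fails on the Type-I KNSS-mild class without scaled energies) is the
  Liouville problem for that class and stays open.

References: Koch–Nadirashvili–Seregin–Šverák, Acta Math. 203 (2009) §4 (the gauge gradient
bound); Majda–Bertozzi, *Vorticity and Incompressible Flow* (2002) §1.1 (curl-type fields).
-/

noncomputable section

open Set Function Filter MeasureTheory Metric
open scoped RealInnerProductSpace ContDiff Topology

namespace Summit.NavierStokesRegularity.NavierStokesRegularity.Theorems.ExtremalBiaxialitySubcritical.Negative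

open Literature.Analysis.FluidPDE
open Summit.NavierStokesRegularity.NavierStokesRegularity.Theses

/-! ### Coordinates and the quadratic stream function -/

/-- Standard basis vector `eᵢ` of `EuclideanSpace ℝ (Fin 3)`. [folklore] -/
def kE (i : Fin 3) : EuclideanSpace ℝ (Fin 3) := EuclideanSpace.single i 1

/-- Coordinates of `eᵢ`. [folklore] -/
@[simp] theorem kE_apply (i j : Fin 3) : kE i j = if j = i then 1 else 0 := by
  simp [kE]

/-- `‖eᵢ‖ = 1`. [folklore] -/
@[simp] theorem norm_kE (i : Fin 3) : ‖kE i‖ = 1 := by simp [kE]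

/-- `⟪eᵢ, z⟫ = zᵢ`. [folklore] -/
@[simp] theorem inner_kE_left (i : Fin 3) (z : EuclideanSpace ℝ (Fin 3)) : ⟪kE i, z⟫ = z i := by
  simp [kE, EuclideanSpace.inner_single_left]

/-- `⟪z, eᵢ⟫ = zᵢ`. [folklore] -/
@[simp] theorem inner_kE_right (i : Fin 3) (z : EuclideanSpace ℝ (Fin 3)) : ⟪z, kE i⟫ = z i := by
  rw [real_inner_comm, inner_kE_left]

/-- The coordinate projections as continuous linear maps. [folklore] -/
abbrev kproj (i : Fin 3) : EuclideanSpace ℝ (Fin 3) →L[ℝ] ℝ := EuclideanSpace.proj i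

/-- The quadratic stream function `P(x) = x₀x₁ − 2x₁x₂`. [folklore] -/
def decoyPoly (x : EuclideanSpace ℝ (Fin 3)) : ℝ := x 0 * x 1 - 2 * (x 1 * x 2)

/-- Its derivative `DP(x) = x₁ dx₀ + (x₀ − 2x₂) dx₁ − 2x₁ dx₂`. [folklore] -/
def decoyPolyDeriv (x : EuclideanSpace ℝ (Fin 3)) : EuclideanSpace ℝ (Fin 3) →L[ℝ] ℝ :=
  (x 1) • kproj 0 + (x 0 - 2 * x 2) • kproj 1 + (-(2 * x 1)) • kproj 2

/-- `DP(x) h = x₁h₀ + (x₀ − 2x₂)h₁ − 2x₁h₂`. [folklore] -/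
theorem decoyPolyDeriv_apply (x h : EuclideanSpace ℝ (Fin 3)) :
    decoyPolyDeriv x h = x 1 * h 0 + (x 0 - 2 * x 2) * h 1 + -(2 * x 1) * h 2 := by
  simp [decoyPolyDeriv]

/-- `P` has derivative `DP`. [folklore] -/
theorem hasFDerivAt_decoyPoly (x : EuclideanSpace ℝ (Fin 3)) :
    HasFDerivAt decoyPoly (decoyPolyDeriv x) x := by
  have h0 : HasFDerivAt (fun y : EuclideanSpace ℝ (Fin 3) => y 0) (kproj 0) x := (kproj 0).hasFDerivAt
  have h1 : HasFDerivAt (fun y : EuclideanSpace ℝ (Fin 3) => y 1) (kproj 1) x := (kproj 1).hasFDerivAt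
  have h2 : HasFDerivAt (fun y : EuclideanSpace ℝ (Fin 3) => y 2) (kproj 2) x := (kproj 2).hasFDerivAt
  have h := (h0.mul h1).sub ((h1.mul h2).const_mul (2 : ℝ))
  refine h.congr_fderiv ?_
  ext v
  simp [decoyPolyDeriv]; ring

/-- `P` is smooth. [folklore] -/
theorem contDiff_decoyPoly : ContDiff ℝ ∞ decoyPoly :=
  ((kproj 0).contDiff.mul (kproj 1).contDiff).sub
    (contDiff_const.mul ((kproj 1).contDiff.mul (kproj 2).contDiff))

/-! ### The bump, the compactly supported stream function and the profile -/

/-- A smooth bump on `ℝ³`: `≡ 1` on the closed unit ball, supported in the ball of radius `2`. [folklore] -/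
def decoyBump : ContDiffBump (0 : EuclideanSpace ℝ (Fin 3)) := ⟨1, 2, one_pos, one_lt_two⟩

/-- The compactly supported stream function `g = ψ · P`. [folklore] -/
def decoyG (x : EuclideanSpace ℝ (Fin 3)) : ℝ := decoyBump x * decoyPoly x

/-- `g` is smooth. [folklore] -/
theorem contDiff_decoyG : ContDiff ℝ ∞ decoyG :=
  decoyBump.contDiff.mul contDiff_decoyPoly

/-- `g` has compact support. [folklore] -/
theorem hasCompactSupport_decoyG : HasCompactSupport decoyG :=
  decoyBump.hasCompactSupport.mul_right

/-- `g` is a test function on `ℝ³`. [folklore] -/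
theorem isTestFunctionOn_decoyG :
    Literature.Analysis.FunctionSpaces.IsTestFunctionOn (⊤ : TopologicalSpace.Opens (EuclideanSpace ℝ (Fin 3))) decoyG :=
  ⟨contDiff_decoyG, hasCompactSupport_decoyG, by simp⟩

/-- On the open unit ball `g = P` (germ-wise). [folklore] -/
theorem decoyG_eventuallyEq {x : EuclideanSpace ℝ (Fin 3)} (hx : x ∈ ball (0 : EuclideanSpace ℝ (Fin 3)) 1) :
    decoyG =ᶠ[𝓝 x] decoyPoly := by
  have hx' : x ∈ ball (0 : EuclideanSpace ℝ (Fin 3)) decoyBump.rIn := hx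
  filter_upwards [decoyBump.eventuallyEq_one_of_mem_ball hx'] with y hy
  simp only [decoyG, hy, Pi.one_apply, one_mul]

/-- On the open unit ball `Dg = DP`. [folklore] -/
theorem fderiv_decoyG {x : EuclideanSpace ℝ (Fin 3)} (hx : x ∈ ball (0 : EuclideanSpace ℝ (Fin 3)) 1) :
    fderiv ℝ decoyG x = decoyPolyDeriv x := by
  rw [(decoyG_eventuallyEq hx).fderiv_eq]
  exact (hasFDerivAt_decoyPoly x).fderiv

/-- **The spatial profile** `W = (∂₀ g) e₁ − (∂₁ g) e₀`, the tree's curl-type field of `g`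
(`isDivFree_curlPair_of_contDiff`): smooth, compactly supported, divergence free. [folklore] -/
def decoyProfile (x : EuclideanSpace ℝ (Fin 3)) : EuclideanSpace ℝ (Fin 3) :=
  fderiv ℝ decoyG x (kE 0) • kE 1 - fderiv ℝ decoyG x (kE 1) • kE 0

/-- `W` is a (vector) test function. [folklore] -/
theorem isTestFunctionOn_decoyProfile :
    Literature.Analysis.FunctionSpaces.IsTestFunctionOn (⊤ : TopologicalSpace.Opens (EuclideanSpace ℝ (Fin 3))) decoyProfile :=
  isTestFunctionOn_curlPair isTestFunctionOn_decoyG (kE 0) (kE 1)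

/-- `W` is smooth. [folklore] -/
theorem contDiff_decoyProfile : ContDiff ℝ ∞ decoyProfile :=
  isTestFunctionOn_decoyProfile.contDiff

/-- `W` has compact support. [folklore] -/
theorem hasCompactSupport_decoyProfile : HasCompactSupport decoyProfile :=
  isTestFunctionOn_decoyProfile.hasCompactSupport

/-- `div W = 0` (Schwarz). [folklore] -/
theorem isDivFree_decoyProfile : VectorCalculus.IsDivFree decoyProfile :=
  isDivFree_curlPair_of_contDiff (contDiff_infty.1 contDiff_decoyG 2) (kE 0) (kE 1)

/-- `W` is continuous. [folklore] -/
theorem continuous_decoyProfile : Continuous decoyProfile := contDiff_decoyProfile.continuous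

/-- `DW` is continuous. [folklore] -/
theorem continuous_fderiv_decoyProfile : Continuous (fderiv ℝ decoyProfile) :=
  contDiff_decoyProfile.continuous_fderiv (by simp)

/-- The linear model `L h = h₁ e₁ − (h₀ − 2h₂) e₀` of `W` near the origin. [folklore] -/
def decoyLin : EuclideanSpace ℝ (Fin 3) →L[ℝ] EuclideanSpace ℝ (Fin 3) :=
  (kproj 1).smulRight (kE 1) - (kproj 0 - (2 : ℝ) • kproj 2).smulRight (kE 0)

/-- `L h = h₁ e₁ − (h₀ − 2h₂) e₀`. [folklore] -/
theorem decoyLin_apply (h : EuclideanSpace ℝ (Fin 3)) :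
    decoyLin h = (h 1) • kE 1 - (h 0 - 2 * h 2) • kE 0 := by
  simp [decoyLin, ContinuousLinearMap.smulRight_apply, smul_eq_mul]

/-- On the open unit ball `W = L`. [folklore] -/
theorem decoyProfile_eq_of_mem {x : EuclideanSpace ℝ (Fin 3)} (hx : x ∈ ball (0 : EuclideanSpace ℝ (Fin 3)) 1) :
    decoyProfile x = decoyLin x := by
  rw [decoyProfile, fderiv_decoyG hx, decoyLin_apply, decoyPolyDeriv_apply, decoyPolyDeriv_apply]
  simp

/-- `W = L` germ-wise at the origin. [folklore] -/
theorem decoyProfile_eventuallyEq : decoyProfile =ᶠ[𝓝 (0 : EuclideanSpace ℝ (Fin 3))] decoyLin := by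
  filter_upwards [Metric.isOpen_ball.mem_nhds (Metric.mem_ball_self (one_pos : (0 : ℝ) < 1))] with x hx
  exact decoyProfile_eq_of_mem hx

/-- `DW(0) = L`. [folklore] -/
theorem fderiv_decoyProfile_zero : fderiv ℝ decoyProfile 0 = decoyLin := by
  rw [decoyProfile_eventuallyEq.fderiv_eq]
  exact decoyLin.fderiv

/-- The quadratic form of `L`: `⟪L z, z⟫ = z₁² − z₀² + 2 z₀ z₂`. [folklore] -/
theorem inner_decoyLin (z : EuclideanSpace ℝ (Fin 3)) :
    ⟪decoyLin z, z⟫ = z 1 ^ 2 - z 0 ^ 2 + 2 * (z 0 * z 2) := by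
  rw [decoyLin_apply, inner_sub_left, real_inner_smul_left, real_inner_smul_left, inner_kE_left,
    inner_kE_left]
  ring

/-! ### The biaxial frame at the origin -/

/-- First frame vector `v = e₁`. [folklore] -/
def frameV : EuclideanSpace ℝ (Fin 3) := kE 1

/-- Second frame vector `w = (e₀ + e₂)/√2`. [folklore] -/
def frameW : EuclideanSpace ℝ (Fin 3) := (Real.sqrt 2)⁻¹ • (kE 0 + kE 2)

/-- `‖e₀ + e₂‖ = √2`. [folklore] -/
theorem norm_kE_zero_add_kE_two : ‖kE 0 + kE 2‖ = Real.sqrt 2 := by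
  rw [EuclideanSpace.norm_eq]
  congr 1
  simp [Fin.sum_univ_three]
  norm_num

/-- `‖v‖ = 1`. [folklore] -/
theorem norm_frameV : ‖frameV‖ = 1 := norm_kE 1

/-- `‖w‖ = 1`. [folklore] -/
theorem norm_frameW : ‖frameW‖ = 1 := by
  have h2 : (0 : ℝ) < Real.sqrt 2 := Real.sqrt_pos.2 (by norm_num)
  rw [frameW, norm_smul, norm_inv, Real.norm_of_nonneg h2.le, norm_kE_zero_add_kE_two,
    inv_mul_cancel₀ h2.ne']

/-- `⟪v, w⟫ = 0`. [folklore] -/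
theorem inner_frameV_frameW : ⟪frameV, frameW⟫ = 0 := by
  simp [frameV, frameW]

/-- Coordinates of `α v + β w`: `(β/√2, α, β/√2)`. [folklore] -/
theorem frame_coords (α β : ℝ) :
    (α • frameV + β • frameW) 0 = β * (Real.sqrt 2)⁻¹ ∧ (α • frameV + β • frameW) 1 = α ∧
      (α • frameV + β • frameW) 2 = β * (Real.sqrt 2)⁻¹ := by
  refine ⟨?_, ?_, ?_⟩ <;> simp [frameV, frameW]

/-- **The frame inequality**: `⟪L z, z⟫ ≥ ½ |z|²` on the plane `span{v, w}` (there
`⟪L z, z⟫ = α² + β²/2`). [folklore] -/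
theorem decoyLin_frame (α β : ℝ) :
    (1 / 2 : ℝ) * (α ^ 2 + β ^ 2) ≤ ⟪decoyLin (α • frameV + β • frameW), α • frameV + β • frameW⟫ := by
  obtain ⟨h0, h1, h2⟩ := frame_coords α β
  rw [inner_decoyLin, h0, h1, h2]
  have hs : (Real.sqrt 2)⁻¹ ^ 2 = 2⁻¹ := by
    rw [inv_pow, Real.sq_sqrt (by norm_num : (0 : ℝ) ≤ 2)]
  nlinarith [hs, sq_nonneg α, sq_nonneg β]

/-! ### The decoy field -/

/-- The time profile: a smooth bump `≡ 1` near `t = −1`, supported in `(−3/2, −1/2)`,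
values in `[0, 1]`. [folklore] -/
def decoyTime : ContDiffBump (-1 : ℝ) := ⟨1 / 4, 1 / 2, by norm_num, by norm_num⟩

/-- `φ(−1) = 1`. [folklore] -/
theorem decoyTime_neg_one : decoyTime (-1) = 1 :=
  decoyTime.one_of_mem_closedBall (mem_closedBall_self decoyTime.rIn_pos.le)

/-- `φ(t) = 0` once `|t + 1| ≥ 1/2`. [folklore] -/
theorem decoyTime_eq_zero {t : ℝ} (ht : 1 / 2 ≤ |t + 1|) : decoyTime t = 0 := by
  apply decoyTime.zero_of_le_dist
  rw [Real.dist_eq, show t - -1 = t + 1 by ring]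
  exact ht

/-- `0 ≤ φ ≤ 1`. [folklore] -/
theorem decoyTime_nonneg (t : ℝ) : 0 ≤ decoyTime t := decoyTime.nonneg

/-- `φ ≤ 1`. [folklore] -/
theorem decoyTime_le_one (t : ℝ) : decoyTime t ≤ 1 := decoyTime.le_one

/-- `φ(t)² ≤ 𝟙_{[−3/2, −1/2]}(t)`. [folklore] -/
theorem decoyTime_sq_le_indicator (t : ℝ) :
    decoyTime t ^ 2 ≤ (Icc (-(3 / 2) : ℝ) (-(1 / 2))).indicator (fun _ => (1 : ℝ)) t := by
  by_cases ht : t ∈ Icc (-(3 / 2) : ℝ) (-(1 / 2))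
  · rw [indicator_of_mem ht]
    have h1 := decoyTime_le_one t
    have h0 := decoyTime_nonneg t
    nlinarith
  · rw [indicator_of_notMem ht]
    have hfar : 1 / 2 ≤ |t + 1| := by
      rw [mem_Icc, not_and_or, not_le, not_le] at ht
      rcases ht with h | h
      · rw [abs_of_neg (by linarith)]; linarith
      · rw [abs_of_pos (by linarith)]; linarith
    rw [decoyTime_eq_zero hfar]
    simp

/-- **The kinematic decoy** `u_{a,δ}(t, x) = φ(t) · a · W(x/δ)`. [folklore] -/
def decoy (a δ : ℝ) (t : ℝ) (x : EuclideanSpace ℝ (Fin 3)) : EuclideanSpace ℝ (Fin 3) :=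
  (decoyTime t * a) • decoyProfile (δ⁻¹ • x)

/-- The decoy is jointly smooth on all of space-time (in particular on `(−∞,0) × ℝ³`). [folklore] -/
theorem contDiffOn_uncurry_decoy (a δ : ℝ) :
    ContDiffOn ℝ (⊤ : ℕ∞) (Function.uncurry (decoy a δ)) (Set.Iio 0 ×ˢ Set.univ) := by
  have h : ContDiff ℝ ∞ (fun p : ℝ × EuclideanSpace ℝ (Fin 3) => (decoyTime p.1 * a) • decoyProfile (δ⁻¹ • p.2)) :=
    ((decoyTime.contDiff.comp contDiff_fst).mul contDiff_const).smul
      (contDiff_decoyProfile.comp (contDiff_snd.const_smul δ⁻¹))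
  exact h.contDiffOn

/-- The slices of the decoy are smooth. [folklore] -/
theorem contDiff_decoy_slice (a δ t : ℝ) : ContDiff ℝ ∞ (decoy a δ t) :=
  (contDiff_decoyProfile.comp (contDiff_id.const_smul δ⁻¹)).const_smul _

/-- `D u(t)(x) = (φ(t) a δ⁻¹) • DW(x/δ)`. [folklore] -/
theorem fderiv_decoy (a δ t : ℝ) (x : EuclideanSpace ℝ (Fin 3)) :
    fderiv ℝ (decoy a δ t) x = (decoyTime t * a * δ⁻¹) • fderiv ℝ decoyProfile (δ⁻¹ • x) :=
  fderiv_const_smul_comp_smul' decoyProfile (decoyTime t * a) δ⁻¹ x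

/-- `div u(t) = 0`. [folklore] -/
theorem isDivFree_decoy (a δ t : ℝ) : VectorCalculus.IsDivFree (decoy a δ t) := by
  intro x
  have h : VectorCalculus.divergence (decoy a δ t) x =
      (decoyTime t * a * δ⁻¹) * VectorCalculus.divergence decoyProfile (δ⁻¹ • x) := by
    simp only [VectorCalculus.divergence, fderiv_decoy, ContinuousLinearMap.toLinearMap_smul, map_smul,
      smul_eq_mul]
  rw [h, isDivFree_decoyProfile (δ⁻¹ • x), mul_zero]

/-- `D u(−1)(0) = (a/δ) • L`. [folklore] -/
theorem fderiv_decoy_negOne_zero (a δ : ℝ) :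
    fderiv ℝ (decoy a δ (-1)) 0 = (a * δ⁻¹) • decoyLin := by
  rw [fderiv_decoy, smul_zero, fderiv_decoyProfile_zero, decoyTime_neg_one, one_mul]

/-- **The decoy attains the crux's lower two-frame clause with value `a/(2δ)` at `(−1, 0)`**
(frame `(e₁, (e₀+e₂)/√2)`), for `a ≥ 0`, `δ > 0`. [folklore] -/
theorem decoy_lamGE {a δ : ℝ} (ha : 0 ≤ a) (hδ : 0 < δ) :
    ∃ v w : EuclideanSpace ℝ (Fin 3), ‖v‖ = 1 ∧ ‖w‖ = 1 ∧ inner ℝ v w = 0 ∧ ∀ α β : ℝ,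
      (a / (2 * δ)) * (α ^ 2 + β ^ 2) ≤
        (-(-1 : ℝ)) * inner ℝ (fderiv ℝ (decoy a δ (-1)) 0 (α • v + β • w)) (α • v + β • w) := by
  refine ⟨frameV, frameW, norm_frameV, norm_frameW, inner_frameV_frameW, fun α β => ?_⟩
  rw [fderiv_decoy_negOne_zero,
    show ((a * δ⁻¹) • decoyLin) (α • frameV + β • frameW) = (a * δ⁻¹) • decoyLin (α • frameV + β • frameW)
      from rfl,
    real_inner_smul_left, neg_neg, one_mul]
  have h := decoyLin_frame α β
  have hc : 0 ≤ a * δ⁻¹ := mul_nonneg ha (inv_nonneg.2 hδ.le)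
  calc a / (2 * δ) * (α ^ 2 + β ^ 2) = (a * δ⁻¹) * ((1 / 2 : ℝ) * (α ^ 2 + β ^ 2)) := by
        field_simp
    _ ≤ (a * δ⁻¹) * ⟪decoyLin (α • frameV + β • frameW), α • frameV + β • frameW⟫ :=
        mul_le_mul_of_nonneg_left h hc

/-! ### The Type-I rate -/

/-- `W` is bounded. [folklore] -/
theorem exists_bound_decoyProfile : ∃ M : ℝ, 0 < M ∧ ∀ y, ‖decoyProfile y‖ ≤ M := by
  obtain ⟨M, hM⟩ := continuous_decoyProfile.bounded_above_of_compact_support hasCompactSupport_decoyProfile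
  exact ⟨max M 1, by positivity, fun y => (hM y).trans (le_max_left _ _)⟩

/-- `DW` is bounded. [folklore] -/
theorem exists_bound_fderiv_decoyProfile : ∃ M : ℝ, 0 < M ∧ ∀ y, ‖fderiv ℝ decoyProfile y‖ ≤ M := by
  obtain ⟨M, hM⟩ := continuous_fderiv_decoyProfile.bounded_above_of_compact_support
    (hasCompactSupport_decoyProfile.fderiv (𝕜 := ℝ))
  exact ⟨max M 1, by positivity, fun y => (hM y).trans (le_max_left _ _)⟩

/-- Pointwise size of the decoy: `‖u(t,x)‖ ≤ φ(t) a M ≤ a M`. [folklore] -/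
theorem norm_decoy_le {a M : ℝ} (ha : 0 ≤ a) (hM : ∀ y, ‖decoyProfile y‖ ≤ M) (δ t : ℝ)
    (x : EuclideanSpace ℝ (Fin 3)) : ‖decoy a δ t x‖ ≤ decoyTime t * a * M := by
  rw [decoy, norm_smul, Real.norm_of_nonneg (mul_nonneg (decoyTime_nonneg t) ha)]
  exact mul_le_mul_of_nonneg_left (hM _) (mul_nonneg (decoyTime_nonneg t) ha)

/-- **The Type-I rate (H4)**: `‖u(t,x)‖ ≤ C/√(−t)` as soon as `a M ≤ C/2` (`φ` lives where
`−t ≤ 3/2`, so `√(−t) ≤ 2` there). [folklore] -/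
theorem hasTypeITimeDecay_decoy {a C M : ℝ} (ha : 0 ≤ a) (hC : 0 ≤ C) (hM : ∀ y, ‖decoyProfile y‖ ≤ M)
    (haM : a * M ≤ C / 2) (δ : ℝ) : HasTypeITimeDecay C (decoy a δ) := by
  intro t ht x
  have hs : 0 < Real.sqrt (-t) := Real.sqrt_pos.2 (by linarith)
  refine (norm_decoy_le ha hM δ t x).trans ?_
  by_cases hfar : 1 / 2 ≤ |t + 1|
  · rw [decoyTime_eq_zero hfar, zero_mul, zero_mul]
    positivity
  · have ht4 : -t ≤ 4 := by
      rw [not_le] at hfar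
      have := (abs_lt.1 hfar).1
      linarith
    have hsq : Real.sqrt (-t) ≤ 2 := by
      rw [show (2 : ℝ) = Real.sqrt (2 ^ 2) by rw [Real.sqrt_sq (by norm_num : (0:ℝ) ≤ 2)]]
      exact Real.sqrt_le_sqrt (by linarith)
    have hM0 : 0 ≤ M := (norm_nonneg _).trans (hM 0)
    calc decoyTime t * a * M ≤ 1 * a * M :=
          mul_le_mul_of_nonneg_right (mul_le_mul_of_nonneg_right (decoyTime_le_one t) ha) hM0
      _ = a * M := by ring
      _ ≤ C / 2 := haM
      _ ≤ C / Real.sqrt (-t) := div_le_div_of_nonneg_left hC hs hsq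

/-! ### Class-maximality from the class-uniform gauge gradient bound -/

/-- The crux's upper two-frame clause with value `m` holds at `(t, x)`, `t < 0`, for ANY field
whose gauge gradient there is at most `m` in operator norm: `(−t)⟪∇v z, z⟫ ≤ (−t)‖∇v‖ |z|²`
(frame `(e₀, e₁)`). [folklore] -/
theorem upper_clause_of_gauge_norm_le {m t : ℝ} (ht : t < 0)
    {v' : ℝ → EuclideanSpace ℝ (Fin 3) → EuclideanSpace ℝ (Fin 3)} {x : EuclideanSpace ℝ (Fin 3)}
    (hK : (-t) * ‖fderiv ℝ (v' t) x‖ ≤ m) :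
    ∃ v w : EuclideanSpace ℝ (Fin 3), ‖v‖ = 1 ∧ ‖w‖ = 1 ∧ inner ℝ v w = 0 ∧ ∀ α β : ℝ,
      (-t) * inner ℝ (fderiv ℝ (v' t) x (α • v + β • w)) (α • v + β • w) ≤ m * (α ^ 2 + β ^ 2) := by
  refine ⟨kE 0, kE 1, norm_kE 0, norm_kE 1, by simp, fun α β => ?_⟩
  set z : EuclideanSpace ℝ (Fin 3) := α • kE 0 + β • kE 1 with hz
  have hzn : ‖z‖ ^ 2 = α ^ 2 + β ^ 2 := norm_sq_smul_add_smul (norm_kE 0) (norm_kE 1) (by simp) α β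
  have ht' : 0 ≤ -t := by linarith
  have h1 : inner ℝ (fderiv ℝ (v' t) x z) z ≤ ‖fderiv ℝ (v' t) x‖ * ‖z‖ ^ 2 :=
    calc inner ℝ (fderiv ℝ (v' t) x z) z ≤ ‖fderiv ℝ (v' t) x z‖ * ‖z‖ := real_inner_le_norm _ _
      _ ≤ ‖fderiv ℝ (v' t) x‖ * ‖z‖ * ‖z‖ :=
          mul_le_mul_of_nonneg_right (ContinuousLinearMap.le_opNorm _ _) (norm_nonneg _)
      _ = ‖fderiv ℝ (v' t) x‖ * ‖z‖ ^ 2 := by ring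
  calc (-t) * inner ℝ (fderiv ℝ (v' t) x z) z ≤ (-t) * (‖fderiv ℝ (v' t) x‖ * ‖z‖ ^ 2) :=
        mul_le_mul_of_nonneg_left h1 ht'
    _ = ((-t) * ‖fderiv ℝ (v' t) x‖) * ‖z‖ ^ 2 := by ring
    _ ≤ m * ‖z‖ ^ 2 := mul_le_mul_of_nonneg_right hK (sq_nonneg _)
    _ = m * (α ^ 2 + β ^ 2) := by rw [hzn]

/-- **Class-maximality is cheap for large values**: by the class-uniform gauge gradient bound
`(−t)‖∇v(t,x)‖ ≤ K₀(C)` on the Type-I KNSS-mild class (tree `exists_gauge_norm_fderiv_le_of_typeI`,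
KNSS 2009 Prop. 4.1), every `m ≥ K₀(C)` satisfies the crux's class-maximality clause over `𝒦_C`
verbatim (the energy clause of the class is not needed). [cite: KochNadirashviliSereginSverak2009, Prop. 4.1 (4.6)/(4.10), k = 1 (arXiv:0709.3599 p. 8)] -/
theorem exists_isClassMax_of_le (C : ℝ) : ∃ K₀ : ℝ, ∀ m : ℝ, K₀ ≤ m →
    ∀ v' : ℝ → EuclideanSpace ℝ (Fin 3) → EuclideanSpace ℝ (Fin 3), (ContDiffOn ℝ (⊤ : ℕ∞) (Function.uncurry v') (Set.Iio 0 ×ˢ Set.univ) ∧ (∀ t < 0, Literature.Analysis.FluidPDE.VectorCalculus.IsDivFree (v' t)) ∧ (∀ s t : ℝ, s < t → t < 0 → ∀ x, v' t x = Literature.Analysis.FluidPDE.heatFlow (v' s) (t-s) x - ∫ τ in Set.Ioo s t, ∫ y, ((-(inner ℝ (x-y) (v' τ y) / (2*(t-τ)) * Literature.Analysis.UnboundedOperators.heatKernel (t-τ) (x-y))) • v' τ y + (∫ σ in Set.Ioi (t-τ), Literature.Analysis.UnboundedOperators.heatKernel σ (x-y) / (4*σ^2)) • (inner ℝ (x-y)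 (v' τ y) • v' τ y + inner ℝ (v' τ y) (v' τ y) • (x-y) + inner ℝ (x-y) (v' τ y) • v' τ y) - ((∫ σ in Set.Ioi (t-τ), Literature.Analysis.UnboundedOperators.heatKernel σ (x-y) / (8*σ^3)) * (inner ℝ (x-y) (v' τ y) * inner ℝ (x-y) (v' τ y))) • (x-y))) ∧ Literature.Analysis.FluidPDE.HasTypeITimeDecay C v' ∧ (∀ (x₀ : EuclideanSpace ℝ (Fin 3)) (t₀ r : ℝ), t₀ ≤ 0 → 0 < r → (∀ t, t₀ - r^2 < t → t < t₀ → r⁻¹ * ∫ x in Metric.ball x₀ r, ‖v' t x‖^2 ≤ C) ∧ r⁻¹ * ∫ t in Set.Ioo (t₀ - r^2) t₀, ∫ x in Metric.ball x₀ r, ‖fderiv ℝ (v' t) x‖^2 ≤ C)) → ∀ t < 0, ∀ x, (∃ v w : EuclideanSpace ℝ (Fin 3), ‖v‖ = 1 ∧ ‖w‖ = 1 ∧ inner ℝ v w = 0 ∧ ∀ α β : ℝ, (-t) * inner ℝ (fderiv ℝ (v' t) x (α • v + β • w)) (α • v + β • w) ≤ m * (α^2 + β^2)) := by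
  obtain ⟨K₀, hK₀⟩ := exists_gauge_norm_fderiv_le_of_typeI C
  refine ⟨K₀, fun m hm v' hv' t ht x => ?_⟩
  obtain ⟨h1, h2, h3, h4, -⟩ := hv'
  have hv : IsTypeIAncientMild C v' := isTypeIAncientMild_of_squeezeClass h1 h2 h3 h4
  exact upper_clause_of_gauge_norm_le ht ((hK₀ hv t ht x).trans hm)


/-! ### Scaled local energies (H5): integrability and scaling -/

/-- The slices of the decoy have compact support (`δ ≠ 0`). [folklore] -/
theorem hasCompactSupport_decoy_slice {δ : ℝ} (hδ : δ ≠ 0) (a t : ℝ) :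
    HasCompactSupport (decoy a δ t) := by
  have h : HasCompactSupport (fun x : EuclideanSpace ℝ (Fin 3) => decoyProfile (δ⁻¹ • x)) :=
    hasCompactSupport_decoyProfile.comp_smul (inv_ne_zero hδ)
  exact h.smul_left (f := fun _ => decoyTime t * a)

/-- `x ↦ ‖u(t,x)‖²` is integrable. [folklore] -/
theorem integrable_norm_sq_decoy {δ : ℝ} (hδ : δ ≠ 0) (a t : ℝ) :
    Integrable (fun x => ‖decoy a δ t x‖ ^ 2) := by
  have hc : Continuous (fun x => ‖decoy a δ t x‖ ^ 2) :=
    ((contDiff_decoy_slice a δ t).continuous.norm).pow 2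
  have hs : HasCompactSupport (fun x => ‖decoy a δ t x‖ ^ 2) :=
    (hasCompactSupport_decoy_slice hδ a t).norm.comp_left (g := fun r : ℝ => r ^ 2) (by simp)
  exact hc.integrable_of_hasCompactSupport hs

/-- `x ↦ ‖∇u(t,x)‖²` is integrable. [folklore] -/
theorem integrable_norm_sq_fderiv_decoy {δ : ℝ} (hδ : δ ≠ 0) (a t : ℝ) :
    Integrable (fun x => ‖fderiv ℝ (decoy a δ t) x‖ ^ 2) := by
  have e : (fun x => ‖fderiv ℝ (decoy a δ t) x‖ ^ 2) =
      fun x => ‖(decoyTime t * a * δ⁻¹) • fderiv ℝ decoyProfile (δ⁻¹ • x)‖ ^ 2 := by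
    funext x; rw [fderiv_decoy]
  rw [e]
  have hc0 : Continuous fun x : EuclideanSpace ℝ (Fin 3) => fderiv ℝ decoyProfile (δ⁻¹ • x) :=
    continuous_fderiv_decoyProfile.comp (continuous_const_smul δ⁻¹)
  have hc1 : Continuous fun x : EuclideanSpace ℝ (Fin 3) =>
      (decoyTime t * a * δ⁻¹) • fderiv ℝ decoyProfile (δ⁻¹ • x) :=
    hc0.const_smul (decoyTime t * a * δ⁻¹)
  have hc : Continuous fun x : EuclideanSpace ℝ (Fin 3) =>
      ‖(decoyTime t * a * δ⁻¹) • fderiv ℝ decoyProfile (δ⁻¹ • x)‖ ^ 2 :=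
    hc1.norm.pow 2
  have hs0 : HasCompactSupport fun x : EuclideanSpace ℝ (Fin 3) => fderiv ℝ decoyProfile (δ⁻¹ • x) :=
    (hasCompactSupport_decoyProfile.fderiv (𝕜 := ℝ)).comp_smul (inv_ne_zero hδ)
  have hs : HasCompactSupport fun x : EuclideanSpace ℝ (Fin 3) =>
      ‖(decoyTime t * a * δ⁻¹) • fderiv ℝ decoyProfile (δ⁻¹ • x)‖ ^ 2 :=
    (hs0.smul_left (f := fun _ => decoyTime t * a * δ⁻¹)).norm.comp_left (g := fun r : ℝ => r ^ 2) (by simp)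
  exact hc.integrable_of_hasCompactSupport hs

/-- `E₀ = ∫ ‖W‖²`. [folklore] -/
def profileEnergy : ℝ := ∫ x, ‖decoyProfile x‖ ^ 2

/-- `E₁ = ∫ ‖DW‖²`. [folklore] -/
def profileGradEnergy : ℝ := ∫ x, ‖fderiv ℝ decoyProfile x‖ ^ 2

/-- `E₀ ≥ 0`. [folklore] -/
theorem profileEnergy_nonneg : 0 ≤ profileEnergy := integral_nonneg fun _ => sq_nonneg _

/-- `E₁ ≥ 0`. [folklore] -/
theorem profileGradEnergy_nonneg : 0 ≤ profileGradEnergy := integral_nonneg fun _ => sq_nonneg _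

/-- `finrank ℝ ℝ³ = 3`. [folklore] -/
theorem finrank_R3 : Module.finrank ℝ (EuclideanSpace ℝ (Fin 3)) = 3 := finrank_euclideanSpace_fin

/-- **Energy of a slice**: `∫ ‖u(t)‖² = (φ(t) a)² δ³ E₀`. [folklore] -/
theorem integral_norm_sq_decoy {δ : ℝ} (hδ : 0 < δ) (a t : ℝ) :
    ∫ x, ‖decoy a δ t x‖ ^ 2 = (decoyTime t * a) ^ 2 * δ ^ 3 * profileEnergy := by
  have e : (fun x => ‖decoy a δ t x‖ ^ 2) =
      fun x => (decoyTime t * a) ^ 2 * ‖decoyProfile (δ⁻¹ • x)‖ ^ 2 := by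
    funext x
    rw [decoy, norm_smul, mul_pow, Real.norm_eq_abs, sq_abs]
  rw [e, integral_const_mul,
    Measure.integral_comp_inv_smul_of_nonneg volume (fun y => ‖decoyProfile y‖ ^ 2) hδ.le,
    finrank_R3, smul_eq_mul, profileEnergy]
  ring

/-- **Enstrophy of a slice**: `∫ ‖∇u(t)‖² = (φ(t) a δ⁻¹)² δ³ E₁`. [folklore] -/
theorem integral_norm_sq_fderiv_decoy {δ : ℝ} (hδ : 0 < δ) (a t : ℝ) :
    ∫ x, ‖fderiv ℝ (decoy a δ t) x‖ ^ 2 = (decoyTime t * a * δ⁻¹) ^ 2 * δ ^ 3 * profileGradEnergy := by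
  have e : (fun x => ‖fderiv ℝ (decoy a δ t) x‖ ^ 2) =
      fun x => (decoyTime t * a * δ⁻¹) ^ 2 * ‖fderiv ℝ decoyProfile (δ⁻¹ • x)‖ ^ 2 := by
    funext x
    rw [fderiv_decoy, norm_smul, mul_pow, Real.norm_eq_abs, sq_abs]
  rw [e, integral_const_mul,
    Measure.integral_comp_inv_smul_of_nonneg volume (fun y => ‖fderiv ℝ decoyProfile y‖ ^ 2) hδ.le,
    finrank_R3, smul_eq_mul, profileGradEnergy]
  ring

/-- The volume of the unit ball of `ℝ³` (a finite positive number whose value is not needed). [folklore] -/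
def unitBallVol : ℝ := (volume (ball (0 : EuclideanSpace ℝ (Fin 3)) 1)).toReal

/-- `v₁ ≥ 0`. [folklore] -/
theorem unitBallVol_nonneg : 0 ≤ unitBallVol := ENNReal.toReal_nonneg

/-- `vol(B_r(x)) = r³ v₁`. [folklore] -/
theorem volume_real_ball {r : ℝ} (hr : 0 < r) (x : EuclideanSpace ℝ (Fin 3)) :
    volume.real (ball x r) = r ^ 3 * unitBallVol := by
  rw [measureReal_def, Measure.addHaar_ball_of_pos volume x hr, finrank_R3, ENNReal.toReal_mul,
    ENNReal.toReal_ofReal (by positivity), unitBallVol]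

/-- A nonnegative function bounded by `B` integrates to at most `B r³ v₁` over a ball. [folklore] -/
theorem setIntegral_ball_le {g : EuclideanSpace ℝ (Fin 3) → ℝ} {B r : ℝ} (hr : 0 < r)
    (x₀ : EuclideanSpace ℝ (Fin 3)) (hg0 : ∀ x, 0 ≤ g x) (hgB : ∀ x, g x ≤ B) :
    ∫ x in ball x₀ r, g x ≤ B * (r ^ 3 * unitBallVol) := by
  have h := norm_setIntegral_le_of_norm_le_const (μ := volume) (s := ball x₀ r) (f := g) (C := B)
    measure_ball_lt_top (fun x _ => by rw [Real.norm_of_nonneg (hg0 x)]; exact hgB x)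
  rw [volume_real_ball hr] at h
  exact (Real.le_norm_self _).trans h

/-- **Small balls, velocity**: `∫_{B_r(x₀)} ‖u(t)‖² ≤ (a M₀)² r³ v₁`. [folklore] -/
theorem setIntegral_norm_sq_decoy_le_vol {a M₀ r : ℝ} (ha : 0 ≤ a) (hM₀ : ∀ y, ‖decoyProfile y‖ ≤ M₀)
    (hr : 0 < r) (δ t : ℝ) (x₀ : EuclideanSpace ℝ (Fin 3)) :
    ∫ x in ball x₀ r, ‖decoy a δ t x‖ ^ 2 ≤ (a * M₀) ^ 2 * (r ^ 3 * unitBallVol) := by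
  refine setIntegral_ball_le hr x₀ (fun x => sq_nonneg _) fun x => ?_
  have hM : 0 ≤ M₀ := (norm_nonneg _).trans (hM₀ 0)
  have h1 : ‖decoy a δ t x‖ ≤ a * M₀ :=
    calc ‖decoy a δ t x‖ ≤ decoyTime t * a * M₀ := norm_decoy_le ha hM₀ δ t x
      _ ≤ 1 * a * M₀ := mul_le_mul_of_nonneg_right (mul_le_mul_of_nonneg_right (decoyTime_le_one t) ha) hM
      _ = a * M₀ := by ring
  exact pow_le_pow_left₀ (norm_nonneg _) h1 2

/-- **Large balls, velocity**: `∫_{B_r(x₀)} ‖u(t)‖² ≤ a² δ³ E₀`. [folklore] -/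
theorem setIntegral_norm_sq_decoy_le_energy {δ : ℝ} (hδ : 0 < δ) (a t r : ℝ) (x₀ : EuclideanSpace ℝ (Fin 3)) :
    ∫ x in ball x₀ r, ‖decoy a δ t x‖ ^ 2 ≤ a ^ 2 * δ ^ 3 * profileEnergy := by
  have h1 : ∫ x in ball x₀ r, ‖decoy a δ t x‖ ^ 2 ≤ ∫ x, ‖decoy a δ t x‖ ^ 2 :=
    setIntegral_le_integral (integrable_norm_sq_decoy hδ.ne' a t) (Eventually.of_forall fun _ => sq_nonneg _)
  refine h1.trans ?_
  rw [integral_norm_sq_decoy hδ]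
  have hφ : (decoyTime t * a) ^ 2 ≤ a ^ 2 := by
    rw [mul_pow]
    have h0 := decoyTime_nonneg t
    have h1 := decoyTime_le_one t
    nlinarith [sq_nonneg a, mul_le_one₀ h1 h0 h1]
  have hrest : 0 ≤ δ ^ 3 * profileEnergy := mul_nonneg (by positivity) profileEnergy_nonneg
  nlinarith

/-- **Small balls, gradient**: `∫_{B_r(x₀)} ‖∇u(t)‖² ≤ (a δ⁻¹ M₁)² r³ v₁`. [folklore] -/
theorem setIntegral_norm_sq_fderiv_decoy_le_vol {a δ M₁ r : ℝ} (ha : 0 ≤ a) (hδ : 0 < δ)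
    (hM₁ : ∀ y, ‖fderiv ℝ decoyProfile y‖ ≤ M₁) (hr : 0 < r) (t : ℝ) (x₀ : EuclideanSpace ℝ (Fin 3)) :
    ∫ x in ball x₀ r, ‖fderiv ℝ (decoy a δ t) x‖ ^ 2 ≤ (a * δ⁻¹ * M₁) ^ 2 * (r ^ 3 * unitBallVol) := by
  refine setIntegral_ball_le hr x₀ (fun x => sq_nonneg _) fun x => ?_
  have hM : 0 ≤ M₁ := (norm_nonneg _).trans (hM₁ 0)
  have hc : 0 ≤ a * δ⁻¹ := mul_nonneg ha (inv_nonneg.2 hδ.le)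
  have h1 : ‖fderiv ℝ (decoy a δ t) x‖ ≤ a * δ⁻¹ * M₁ := by
    rw [fderiv_decoy, norm_smul, Real.norm_of_nonneg (mul_nonneg (mul_nonneg (decoyTime_nonneg t) ha)
      (inv_nonneg.2 hδ.le))]
    calc decoyTime t * a * δ⁻¹ * ‖fderiv ℝ decoyProfile (δ⁻¹ • x)‖
        ≤ 1 * a * δ⁻¹ * M₁ := by
          apply mul_le_mul _ (hM₁ _) (norm_nonneg _) (by positivity)
          exact mul_le_mul_of_nonneg_right (mul_le_mul_of_nonneg_right (decoyTime_le_one t) ha)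
            (inv_nonneg.2 hδ.le)
      _ = a * δ⁻¹ * M₁ := by ring
  exact pow_le_pow_left₀ (norm_nonneg _) h1 2

/-- **Large balls, gradient**: `∫_{B_r(x₀)} ‖∇u(t)‖² ≤ φ(t)² (a² δ E₁)`. [folklore] -/
theorem setIntegral_norm_sq_fderiv_decoy_le_energy {δ : ℝ} (hδ : 0 < δ) (a t r : ℝ)
    (x₀ : EuclideanSpace ℝ (Fin 3)) :
    ∫ x in ball x₀ r, ‖fderiv ℝ (decoy a δ t) x‖ ^ 2 ≤ decoyTime t ^ 2 * (a ^ 2 * δ * profileGradEnergy) := by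
  have h1 : ∫ x in ball x₀ r, ‖fderiv ℝ (decoy a δ t) x‖ ^ 2 ≤ ∫ x, ‖fderiv ℝ (decoy a δ t) x‖ ^ 2 :=
    setIntegral_le_integral (integrable_norm_sq_fderiv_decoy hδ.ne' a t)
      (Eventually.of_forall fun _ => sq_nonneg _)
  refine h1.trans (le_of_eq ?_)
  rw [integral_norm_sq_fderiv_decoy hδ,
    show (decoyTime t * a * δ⁻¹) ^ 2 * δ ^ 3 * profileGradEnergy =
      decoyTime t ^ 2 * (a ^ 2 * δ * profileGradEnergy) * (δ⁻¹ * δ) ^ 2 by ring,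
    inv_mul_cancel₀ hδ.ne', one_pow, mul_one]

/-! ### Scaled local energies (H5): the time integral -/

/-- `φ²` is integrable. [folklore] -/
theorem integrable_decoyTime_sq : Integrable (fun t : ℝ => decoyTime t ^ 2) := by
  have hc : Continuous (fun t : ℝ => decoyTime t ^ 2) := (decoyTime.continuous).pow 2
  have hs0 : HasCompactSupport (fun t : ℝ => decoyTime t) := decoyTime.hasCompactSupport
  have hs : HasCompactSupport (fun t : ℝ => decoyTime t ^ 2) :=
    hs0.comp_left (g := fun r : ℝ => r ^ 2) (zero_pow two_ne_zero)
  exact hc.integrable_of_hasCompactSupport hs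

/-- `∫ φ² ≤ 1` (`φ² ≤ 𝟙_{[−3/2,−1/2]}`). [folklore] -/
theorem integral_decoyTime_sq_le_one : ∫ t, decoyTime t ^ 2 ≤ 1 := by
  have hI : Integrable fun t : ℝ => (Icc (-(3 / 2) : ℝ) (-(1 / 2))).indicator (fun _ => (1 : ℝ)) t :=
    (integrableOn_const (s := Icc (-(3 / 2) : ℝ) (-(1 / 2))) (hs := measure_Icc_lt_top.ne)).integrable_indicator
      measurableSet_Icc
  have h := integral_mono integrable_decoyTime_sq hI decoyTime_sq_le_indicator
  refine h.trans (le_of_eq ?_)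
  rw [integral_indicator_const _ measurableSet_Icc, Real.volume_real_Icc_of_le (by norm_num), smul_eq_mul]
  norm_num

/-- **Time integral, small radius**: `∫_{t₀−r²}^{t₀} ∫_{B_r} ‖∇u‖² ≤ r² · (a δ⁻¹ M₁)² r³ v₁`. [folklore] -/
theorem timeIntegral_grad_le_vol {a δ M₁ r : ℝ} (ha : 0 ≤ a) (hδ : 0 < δ)
    (hM₁ : ∀ y, ‖fderiv ℝ decoyProfile y‖ ≤ M₁) (hr : 0 < r) (t₀ : ℝ) (x₀ : EuclideanSpace ℝ (Fin 3)) :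
    ∫ t in Ioo (t₀ - r ^ 2) t₀, ∫ x in ball x₀ r, ‖fderiv ℝ (decoy a δ t) x‖ ^ 2 ≤
      r ^ 2 * ((a * δ⁻¹ * M₁) ^ 2 * (r ^ 3 * unitBallVol)) := by
  set B : ℝ := (a * δ⁻¹ * M₁) ^ 2 * (r ^ 3 * unitBallVol) with hB
  have hmono : ∫ t in Ioo (t₀ - r ^ 2) t₀, ∫ x in ball x₀ r, ‖fderiv ℝ (decoy a δ t) x‖ ^ 2 ≤
      ∫ t in Ioo (t₀ - r ^ 2) t₀, B := by
    refine integral_mono_of_nonneg (Eventually.of_forall fun t => ?_)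
      (integrableOn_const (hs := measure_Ioo_lt_top.ne)) ?_
    · exact setIntegral_nonneg measurableSet_ball fun x _ => sq_nonneg _
    · exact Eventually.of_forall fun t => setIntegral_norm_sq_fderiv_decoy_le_vol ha hδ hM₁ hr t x₀
  refine hmono.trans (le_of_eq ?_)
  rw [setIntegral_const, Real.volume_real_Ioo_of_le (by nlinarith), smul_eq_mul]
  ring

/-- **Time integral, large radius**: `∫_{t₀−r²}^{t₀} ∫_{B_r} ‖∇u‖² ≤ a² δ E₁`. [folklore] -/
theorem timeIntegral_grad_le_energy {δ : ℝ} (hδ : 0 < δ) (a r t₀ : ℝ) (x₀ : EuclideanSpace ℝ (Fin 3)) :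
    ∫ t in Ioo (t₀ - r ^ 2) t₀, ∫ x in ball x₀ r, ‖fderiv ℝ (decoy a δ t) x‖ ^ 2 ≤
      a ^ 2 * δ * profileGradEnergy := by
  set K : ℝ := a ^ 2 * δ * profileGradEnergy with hK
  have hK0 : 0 ≤ K := mul_nonneg (mul_nonneg (sq_nonneg _) hδ.le) profileGradEnergy_nonneg
  have hint : Integrable fun t => decoyTime t ^ 2 * K := integrable_decoyTime_sq.mul_const K
  have h1 : ∫ t in Ioo (t₀ - r ^ 2) t₀, ∫ x in ball x₀ r, ‖fderiv ℝ (decoy a δ t) x‖ ^ 2 ≤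
      ∫ t in Ioo (t₀ - r ^ 2) t₀, decoyTime t ^ 2 * K := by
    refine integral_mono_of_nonneg (Eventually.of_forall fun t => ?_) hint.integrableOn ?_
    · exact setIntegral_nonneg measurableSet_ball fun x _ => sq_nonneg _
    · exact Eventually.of_forall fun t => setIntegral_norm_sq_fderiv_decoy_le_energy hδ a t r x₀
  have h2 : ∫ t in Ioo (t₀ - r ^ 2) t₀, decoyTime t ^ 2 * K ≤ ∫ t, decoyTime t ^ 2 * K :=
    setIntegral_le_integral hint (Eventually.of_forall fun t => mul_nonneg (sq_nonneg _) hK0)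
  have h3 : ∫ t, decoyTime t ^ 2 * K ≤ K := by
    rw [integral_mul_const]
    calc (∫ t, decoyTime t ^ 2) * K ≤ 1 * K := mul_le_mul_of_nonneg_right integral_decoyTime_sq_le_one hK0
      _ = K := one_mul K
  exact h1.trans (h2.trans h3)


/-! ### Kinematic admissibility with prescribed constant and prescribed squeeze -/

/-- **The kinematic decoy with prescribed Type-I constant and prescribed squeeze.** For every
`C > 0` and every `m`, some field `u` satisfies the four KINEMATIC clauses of the crux's class
`𝒦_C` verbatim — (H1) joint smoothness on `(−∞,0) × ℝ³`, (H2) `div u(t) = 0`, (H4) the Type-I rate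
`‖u(t,x)‖ ≤ C/√(−t)`, (H5) scaled local energies `≤ C` in every backward parabolic cylinder — and
attains the crux's lower two-frame clause with value `m` at `(t₀, x₀) = (−1, 0)`, i.e.
`Λ_u(−1, 0) ≥ m`. Witness: the decoy `u = φ(t) a W(x/δ)` with `δ = a/2m` and `a` small (its scaled
energies are `O(a)` uniformly in the radius: small cylinders are controlled by the pointwise size
`a M₀`, `2m M₁` of `u`, `∇u` and the ball volume, large ones by the total energy `a⁵E₀/8m³` and
enstrophy `a³E₁/2m` of the compactly supported slices and by `∫φ² ≤ 1`). Hence nothing short of the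
dynamics (the Oseen identity H3) bounds the Leray-gauge middle strain eigenvalue on `𝒦_C`: compare
the KNSS gauge bound `Λ ≤ K₀(C)` on `𝒦_C` (`exists_gauge_norm_fderiv_le_of_typeI`) and `𝒦_C = {0}`
for `C ≤ ε` (`squeezeClass_eq_zero_of_small`). [folklore] -/
theorem exists_kinematic_decoy {C : ℝ} (hC : 0 < C) (m : ℝ) :
    ∃ u : ℝ → EuclideanSpace ℝ (Fin 3) → EuclideanSpace ℝ (Fin 3), (ContDiffOn ℝ (⊤ : ℕ∞) (Function.uncurry u) (Set.Iio 0 ×ˢ Set.univ) ∧ (∀ t < 0, Literature.Analysis.FluidPDE.VectorCalculus.IsDivFree (u t)) ∧ Literature.Analysis.FluidPDE.HasTypeITimeDecay C u ∧ (∀ (x₀ : EuclideanSpace ℝ (Fin 3)) (t₀ r : ℝ), t₀ ≤ 0 → 0 < r → (∀ t, t₀ - r^2 < t → t < t₀ → r⁻¹ * ∫ x in Metric.ball x₀ r, ‖u t x‖^2 ≤ C) ∧ r⁻¹ * ∫ t in Set.Ioo (t₀ - r^2) t₀, ∫ x in Metric.ball x₀ r, ‖fderiv ℝ (u t) x‖^2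 ≤ C)) ∧
      (∃ v w : EuclideanSpace ℝ (Fin 3), ‖v‖ = 1 ∧ ‖w‖ = 1 ∧ inner ℝ v w = 0 ∧ ∀ α β : ℝ, m * (α^2 + β^2) ≤ (-(-1 : ℝ)) * inner ℝ (fderiv ℝ (u (-1)) 0 (α • v + β • w)) (α • v + β • w)) := by
  -- WLOG the target value is positive
  suffices h : ∀ m : ℝ, 0 < m → ∃ u : ℝ → EuclideanSpace ℝ (Fin 3) → EuclideanSpace ℝ (Fin 3), (ContDiffOn ℝ (⊤ : ℕ∞) (Function.uncurry u) (Set.Iio 0 ×ˢ Set.univ) ∧ (∀ t < 0, Literature.Analysis.FluidPDE.VectorCalculus.IsDivFree (u t)) ∧ Literature.Analysis.FluidPDE.HasTypeITimeDecay C u ∧ (∀ (x₀ : EuclideanSpace ℝ (Fin 3)) (t₀ r : ℝ), t₀ ≤ 0 → 0 < r → (∀ t, t₀ - r^2 < t → t < t₀ → r⁻¹ * ∫ x in Metric.ball x₀ r, ‖u t x‖^2 ≤ C) ∧ r⁻¹ * ∫ t in Set.Ioo (t₀ - r^2) t₀, ∫ x in Metric.ball x₀ r, ‖fderiv ℝ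 (u t) x‖^2 ≤ C)) ∧
      (∃ v w : EuclideanSpace ℝ (Fin 3), ‖v‖ = 1 ∧ ‖w‖ = 1 ∧ inner ℝ v w = 0 ∧ ∀ α β : ℝ, m * (α^2 + β^2) ≤ (-(-1 : ℝ)) * inner ℝ (fderiv ℝ (u (-1)) 0 (α • v + β • w)) (α • v + β • w)) by
    obtain ⟨u, hu, v, w, hv, hw, hvw, hGE⟩ := h (max m 1) (by positivity)
    refine ⟨u, hu, v, w, hv, hw, hvw, fun α β => le_trans ?_ (hGE α β)⟩
    exact mul_le_mul_of_nonneg_right (le_max_left m 1) (by positivity)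
  intro m hm
  obtain ⟨M₀, hM₀pos, hM₀⟩ := exists_bound_decoyProfile
  obtain ⟨M₁, hM₁pos, hM₁⟩ := exists_bound_fderiv_decoyProfile
  have hv0 : 0 ≤ unitBallVol := unitBallVol_nonneg
  have hE0 : 0 ≤ profileEnergy := profileEnergy_nonneg
  have hE1 : 0 ≤ profileGradEnergy := profileGradEnergy_nonneg
  -- the small radius `ρ`: `Q ρ ≤ C`, `Q = (2 m M₁)² v₁`
  set Q : ℝ := (2 * m * M₁) ^ 2 * unitBallVol with hQ
  have hQ0 : 0 ≤ Q := mul_nonneg (sq_nonneg _) hv0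
  set ρ : ℝ := min 1 (C / (Q + 1)) with hρ
  have hρ0 : 0 < ρ := lt_min one_pos (div_pos hC (by linarith))
  have hρ1 : ρ ≤ 1 := min_le_left _ _
  have hρQ : Q * ρ ≤ C := by
    have h1 : ρ ≤ C / (Q + 1) := min_le_right _ _
    have h2 : Q * ρ ≤ Q * (C / (Q + 1)) := mul_le_mul_of_nonneg_left h1 hQ0
    have h3 : Q * (C / (Q + 1)) ≤ C := by
      rw [mul_div_assoc', div_le_iff₀ (by linarith)]
      nlinarith
    linarith
  -- the amplitude `a`: `a K ≤ C`, `a ≤ 1`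
  set K : ℝ := profileEnergy / (8 * m ^ 3 * ρ) + profileGradEnergy / (2 * m * ρ) +
    M₀ ^ 2 * unitBallVol * ρ ^ 2 + 2 * M₀ + 1 with hK
  have hK1 : 0 ≤ profileEnergy / (8 * m ^ 3 * ρ) := by positivity
  have hK2 : 0 ≤ profileGradEnergy / (2 * m * ρ) := by positivity
  have hK3 : 0 ≤ M₀ ^ 2 * unitBallVol * ρ ^ 2 := by positivity
  have hK0 : 0 < K := by linarith
  set a : ℝ := min 1 (C / K) with ha
  have ha0 : 0 < a := lt_min one_pos (div_pos hC hK0)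
  have ha1 : a ≤ 1 := min_le_left _ _
  have haK : a * K ≤ C := by
    have h1 : a ≤ C / K := min_le_right _ _
    calc a * K ≤ C / K * K := mul_le_mul_of_nonneg_right h1 hK0.le
      _ = C := div_mul_cancel₀ C hK0.ne'
  -- the spatial scale `δ = a / 2m`
  set δ : ℝ := a / (2 * m) with hδ
  have hδ0 : 0 < δ := div_pos ha0 (by positivity)
  have haδ : a * δ⁻¹ = 2 * m := by
    rw [hδ]
    field_simp
  have hval : a / (2 * δ) = m := by
    rw [hδ]
    field_simp
  -- powers of `a ≤ 1`
  have ha2 : a ^ 2 ≤ a := by nlinarith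
  have ha4 : a ^ 4 ≤ 1 := pow_le_one₀ ha0.le ha1
  refine ⟨decoy a δ, ⟨contDiffOn_uncurry_decoy a δ, fun t _ => isDivFree_decoy a δ t, ?_, ?_⟩, ?_⟩
  · -- (H4): `a M₀ ≤ C / 2`
    refine hasTypeITimeDecay_decoy ha0.le hC.le hM₀ ?_ δ
    have h1 : a * (2 * M₀) ≤ a * K := mul_le_mul_of_nonneg_left (by linarith) ha0.le
    linarith
  · -- (H5)
    intro x₀ t₀ r _ hr
    refine ⟨fun t _ _ => ?_, ?_⟩
    · rcases le_or_gt r ρ with hrρ | hrρ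
      · -- small ball: pointwise size and ball volume
        have h1 := setIntegral_norm_sq_decoy_le_vol ha0.le hM₀ hr δ t x₀
        have hr2 : r ^ 2 ≤ ρ ^ 2 := pow_le_pow_left₀ hr.le hrρ 2
        calc r⁻¹ * ∫ x in Metric.ball x₀ r, ‖decoy a δ t x‖ ^ 2
            ≤ r⁻¹ * ((a * M₀) ^ 2 * (r ^ 3 * unitBallVol)) :=
              mul_le_mul_of_nonneg_left h1 (inv_nonneg.2 hr.le)
          _ = a ^ 2 * (M₀ ^ 2 * unitBallVol * r ^ 2) := by
              field_simp
          _ ≤ a * (M₀ ^ 2 * unitBallVol * ρ ^ 2) := by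
              apply mul_le_mul ha2 _ (by positivity) ha0.le
              exact mul_le_mul_of_nonneg_left hr2 (by positivity)
          _ ≤ a * K := mul_le_mul_of_nonneg_left (by linarith) ha0.le
          _ ≤ C := haK
      · -- large ball: total energy of the slice
        have h1 := setIntegral_norm_sq_decoy_le_energy hδ0 a t r x₀
        have hpos : 0 ≤ a ^ 2 * δ ^ 3 * profileEnergy := by positivity
        calc r⁻¹ * ∫ x in Metric.ball x₀ r, ‖decoy a δ t x‖ ^ 2
            ≤ r⁻¹ * (a ^ 2 * δ ^ 3 * profileEnergy) := mul_le_mul_of_nonneg_left h1 (inv_nonneg.2 hr.le)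
          _ ≤ ρ⁻¹ * (a ^ 2 * δ ^ 3 * profileEnergy) :=
              mul_le_mul_of_nonneg_right (inv_anti₀ hρ0 hrρ.le) hpos
          _ = a * (a ^ 4 * (profileEnergy / (8 * m ^ 3 * ρ))) := by
              rw [hδ]
              field_simp
              ring
          _ ≤ a * (profileEnergy / (8 * m ^ 3 * ρ)) := by
              apply mul_le_mul_of_nonneg_left _ ha0.le
              calc a ^ 4 * (profileEnergy / (8 * m ^ 3 * ρ)) ≤ 1 * (profileEnergy / (8 * m ^ 3 * ρ)) :=
                    mul_le_mul_of_nonneg_right ha4 hK1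
                _ = profileEnergy / (8 * m ^ 3 * ρ) := one_mul _
          _ ≤ a * K := mul_le_mul_of_nonneg_left (by linarith) ha0.le
          _ ≤ C := haK
    · rcases le_or_gt r ρ with hrρ | hrρ
      · -- small cylinder: pointwise size of the gradient, ball volume and the length `r²`
        have h1 := timeIntegral_grad_le_vol ha0.le hδ0 hM₁ hr t₀ x₀
        have hr4 : r ^ 4 ≤ ρ ^ 4 := pow_le_pow_left₀ hr.le hrρ 4
        have hρ4 : ρ ^ 4 ≤ ρ := by
          calc ρ ^ 4 = ρ ^ 3 * ρ := by ring
            _ ≤ 1 * ρ := mul_le_mul_of_nonneg_right (pow_le_one₀ hρ0.le hρ1) hρ0.le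
            _ = ρ := one_mul ρ
        calc r⁻¹ * ∫ t in Set.Ioo (t₀ - r ^ 2) t₀, ∫ x in Metric.ball x₀ r, ‖fderiv ℝ (decoy a δ t) x‖ ^ 2
            ≤ r⁻¹ * (r ^ 2 * ((a * δ⁻¹ * M₁) ^ 2 * (r ^ 3 * unitBallVol))) :=
              mul_le_mul_of_nonneg_left h1 (inv_nonneg.2 hr.le)
          _ = Q * r ^ 4 := by
              rw [haδ, hQ]
              field_simp
          _ ≤ Q * ρ ^ 4 := mul_le_mul_of_nonneg_left hr4 hQ0
          _ ≤ Q * ρ := mul_le_mul_of_nonneg_left hρ4 hQ0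
          _ ≤ C := hρQ
      · -- large cylinder: total enstrophy of the slices and `∫ φ² ≤ 1`
        have h1 := timeIntegral_grad_le_energy hδ0 a r t₀ x₀
        have hpos : 0 ≤ a ^ 2 * δ * profileGradEnergy := by positivity
        calc r⁻¹ * ∫ t in Set.Ioo (t₀ - r ^ 2) t₀, ∫ x in Metric.ball x₀ r, ‖fderiv ℝ (decoy a δ t) x‖ ^ 2
            ≤ r⁻¹ * (a ^ 2 * δ * profileGradEnergy) := mul_le_mul_of_nonneg_left h1 (inv_nonneg.2 hr.le)
          _ ≤ ρ⁻¹ * (a ^ 2 * δ * profileGradEnergy) :=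
              mul_le_mul_of_nonneg_right (inv_anti₀ hρ0 hrρ.le) hpos
          _ = a * (a ^ 2 * (profileGradEnergy / (2 * m * ρ))) := by
              rw [hδ]
              field_simp
          _ ≤ a * (profileGradEnergy / (2 * m * ρ)) := by
              apply mul_le_mul_of_nonneg_left _ ha0.le
              calc a ^ 2 * (profileGradEnergy / (2 * m * ρ)) ≤ 1 * (profileGradEnergy / (2 * m * ρ)) :=
                    mul_le_mul_of_nonneg_right (ha2.trans ha1) hK2
                _ = profileGradEnergy / (2 * m * ρ) := one_mul _
          _ ≤ a * K := mul_le_mul_of_nonneg_left (by linarith) ha0.le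
          _ ≤ C := haK
  · -- the squeeze: `Λ_u(−1, 0) ≥ a/(2δ) = m`
    have h := decoy_lamGE ha0.le hδ0
    rwa [hval] at h

/-! ### The Oseen identity is load-bearing, with every kinematic clause kept -/

/-- **The Oseen identity is load-bearing at every positive Type-I constant.** `WithoutOseen C` —
the crux `ExtremalBiaxialitySubcritical` at constant `C` with the membership `u ∈ 𝒦_C` of the
extremal element WEAKENED to the kinematic clauses of the class ((H1) joint smoothness, (H2)
incompressibility, (H4) the Type-I rate, (H5) scaled local energies, all with constant `C`; only the
Oseen identity (H3) dropped), the attainment clause and the GENUINE class-maximality clause over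
`𝒦_C` kept verbatim — is FALSE for `C > 0`: with `K₀(C)` the class-uniform gauge gradient bound
(`exists_isClassMax_of_le`), the value `m = max(K₀(C), 1/8)` is class-maximal over `𝒦_C`, and the
kinematic decoy of `exists_kinematic_decoy` attains it at `(−1, 0)` while satisfying every clause of
`𝒦_C` except the Oseen identity; but `m ≥ 1/8`. Together with `Negative/ExactStrainFlows` (exact
Navier–Stokes flows of arbitrary gauge middle eigenvalue, violating the Type-I rate): each of the
dynamics (H3) and the Type-I rate (H4) is load-bearing on its own, and no argument that uses the
class only through smoothness, incompressibility, the Type-I rate and the scaled energies can prove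
the crux. [folklore] -/
theorem false_without_oseen {C : ℝ} (hC : 0 < C) :
    ¬ ∀ (m : ℝ) (u : ℝ → EuclideanSpace ℝ (Fin 3) → EuclideanSpace ℝ (Fin 3)) (t₀ : ℝ) (x₀ : EuclideanSpace ℝ (Fin 3)), t₀ < 0 →
      (ContDiffOn ℝ (⊤ : ℕ∞) (Function.uncurry u) (Set.Iio 0 ×ˢ Set.univ) ∧ (∀ t < 0, Literature.Analysis.FluidPDE.VectorCalculus.IsDivFree (u t)) ∧ Literature.Analysis.FluidPDE.HasTypeITimeDecay C u ∧ (∀ (x₀ : EuclideanSpace ℝ (Fin 3)) (t₀ r : ℝ), t₀ ≤ 0 → 0 < r → (∀ t, t₀ - r^2 < t → t < t₀ → r⁻¹ * ∫ x in Metric.ball x₀ r, ‖u t x‖^2 ≤ C) ∧ r⁻¹ * ∫ t in Set.Ioo (t₀ - r^2) t₀, ∫ x in Metric.ball x₀ r, ‖fderiv ℝ (u t) x‖^2 ≤ C)) →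
      (∃ v w : EuclideanSpace ℝ (Fin 3), ‖v‖ = 1 ∧ ‖w‖ = 1 ∧ inner ℝ v w = 0 ∧ ∀ α β : ℝ, m * (α^2 + β^2) ≤ (-t₀) * inner ℝ (fderiv ℝ (u t₀) x₀ (α • v + β • w)) (α • v + β • w)) →
      (∀ v' : ℝ → EuclideanSpace ℝ (Fin 3) → EuclideanSpace ℝ (Fin 3), ContDiffOn ℝ (⊤ : ℕ∞) (Function.uncurry v') (Set.Iio 0 ×ˢ Set.univ) ∧ (∀ t < 0, Literature.Analysis.FluidPDE.VectorCalculus.IsDivFree (v' t)) ∧ (∀ s t : ℝ, s < t → t < 0 → ∀ x, v' t x = Literature.Analysis.FluidPDE.heatFlow (v' s) (t-s) x - ∫ τ in Set.Ioo s t, ∫ y, ((-(inner ℝ (x-y) (v' τ y) / (2*(t-τ)) * Literature.Analysis.UnboundedOperators.heatKernel (t-τ) (x-y))) • v' τ y + (∫ σ in Set.Ioi (t-τ), Literature.Analysis.UnboundedOperators.heatKernel σ (x-y) / (4*σ^2)) • (inner ℝ (x-y) (v' τ y) • v' τ y + inner ℝ (v' τ y) (v' τ y) • (x-y) + inner ℝ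 (x-y) (v' τ y) • v' τ y) - ((∫ σ in Set.Ioi (t-τ), Literature.Analysis.UnboundedOperators.heatKernel σ (x-y) / (8*σ^3)) * (inner ℝ (x-y) (v' τ y) * inner ℝ (x-y) (v' τ y))) • (x-y))) ∧ Literature.Analysis.FluidPDE.HasTypeITimeDecay C v' ∧ (∀ (x₀ : EuclideanSpace ℝ (Fin 3)) (t₀ r : ℝ), t₀ ≤ 0 → 0 < r → (∀ t, t₀ - r^2 < t → t < t₀ → r⁻¹ * ∫ x in Metric.ball x₀ r, ‖v' t x‖^2 ≤ C) ∧ r⁻¹ * ∫ t in Set.Ioo (t₀ - r^2) t₀, ∫ x in Metric.ball x₀ r, ‖fderiv ℝ (v' t) x‖^2 ≤ C) → ∀ t < 0, ∀ x, (∃ v w : EuclideanSpace ℝ (Fin 3), ‖v‖ = 1 ∧ ‖w‖ = 1 ∧ inner ℝ v w = 0 ∧ ∀ α β : ℝ, (-t) * inner ℝ (fderiv ℝ (v' t) x (α • v + β • w)) (α • v + β • w) ≤ m * (α^2 + β^2))) →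
      m < 1 / 8 := by
  intro h
  obtain ⟨K₀, hK₀⟩ := exists_isClassMax_of_le C
  obtain ⟨u, hu, hGE⟩ := exists_kinematic_decoy hC (max K₀ (1 / 8))
  have hlt : max K₀ (1 / 8) < 1 / 8 :=
    h (max K₀ (1 / 8)) u (-1) 0 (by norm_num) hu hGE (hK₀ (max K₀ (1 / 8)) (le_max_left _ _))
  exact absurd hlt (not_lt.2 (le_max_right _ _))

/-- **… and only there**: `WithoutOseen 0` is TRUE — a field with Type-I rate of constant `0`
vanishes on `t < 0`, so an attained lower two-frame value is `≤ 0 < 1/8` (no maximality needed).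
The positivity assumption of `false_without_oseen` is sharp. [folklore] -/
theorem withoutOseen_zero :
    ∀ (m : ℝ) (u : ℝ → EuclideanSpace ℝ (Fin 3) → EuclideanSpace ℝ (Fin 3)) (t₀ : ℝ) (x₀ : EuclideanSpace ℝ (Fin 3)), t₀ < 0 →
      (ContDiffOn ℝ (⊤ : ℕ∞) (Function.uncurry u) (Set.Iio 0 ×ˢ Set.univ) ∧ (∀ t < 0, Literature.Analysis.FluidPDE.VectorCalculus.IsDivFree (u t)) ∧ Literature.Analysis.FluidPDE.HasTypeITimeDecay 0 u ∧ (∀ (x₀ : EuclideanSpace ℝ (Fin 3)) (t₀ r : ℝ), t₀ ≤ 0 → 0 < r → (∀ t, t₀ - r^2 < t → t < t₀ → r⁻¹ * ∫ x in Metric.ball x₀ r, ‖u t x‖^2 ≤ 0) ∧ r⁻¹ * ∫ t in Set.Ioo (t₀ - r^2) t₀, ∫ x in Metric.ball x₀ r, ‖fderiv ℝ (u t) x‖^2 ≤ 0)) →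
      (∃ v w : EuclideanSpace ℝ (Fin 3), ‖v‖ = 1 ∧ ‖w‖ = 1 ∧ inner ℝ v w = 0 ∧ ∀ α β : ℝ, m * (α^2 + β^2) ≤ (-t₀) * inner ℝ (fderiv ℝ (u t₀) x₀ (α • v + β • w)) (α • v + β • w)) →
      (∀ v' : ℝ → EuclideanSpace ℝ (Fin 3) → EuclideanSpace ℝ (Fin 3), ContDiffOn ℝ (⊤ : ℕ∞) (Function.uncurry v') (Set.Iio 0 ×ˢ Set.univ) ∧ (∀ t < 0, Literature.Analysis.FluidPDE.VectorCalculus.IsDivFree (v' t)) ∧ (∀ s t : ℝ, s < t → t < 0 → ∀ x, v' t x = Literature.Analysis.FluidPDE.heatFlow (v' s) (t-s) x - ∫ τ in Set.Ioo s t, ∫ y, ((-(inner ℝ (x-y) (v' τ y) / (2*(t-τ)) * Literature.Analysis.UnboundedOperators.heatKernel (t-τ) (x-y))) • v' τ y + (∫ σ in Set.Ioi (t-τ), Literature.Analysis.UnboundedOperators.heatKernel σ (x-y) / (4*σ^2)) • (inner ℝ (x-y) (v' τ y) • v' τ y + inner ℝ (v' τ y) (v' τ y) • (x-y) + inner ℝ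 (x-y) (v' τ y) • v' τ y) - ((∫ σ in Set.Ioi (t-τ), Literature.Analysis.UnboundedOperators.heatKernel σ (x-y) / (8*σ^3)) * (inner ℝ (x-y) (v' τ y) * inner ℝ (x-y) (v' τ y))) • (x-y))) ∧ Literature.Analysis.FluidPDE.HasTypeITimeDecay 0 v' ∧ (∀ (x₀ : EuclideanSpace ℝ (Fin 3)) (t₀ r : ℝ), t₀ ≤ 0 → 0 < r → (∀ t, t₀ - r^2 < t → t < t₀ → r⁻¹ * ∫ x in Metric.ball x₀ r, ‖v' t x‖^2 ≤ 0) ∧ r⁻¹ * ∫ t in Set.Ioo (t₀ - r^2) t₀, ∫ x in Metric.ball x₀ r, ‖fderiv ℝ (v' t) x‖^2 ≤ 0) → ∀ t < 0, ∀ x, (∃ v w : EuclideanSpace ℝ (Fin 3), ‖v‖ = 1 ∧ ‖w‖ = 1 ∧ inner ℝ v w = 0 ∧ ∀ α β : ℝ, (-t) * inner ℝ (fderiv ℝ (v' t) x (α • v + β • w)) (α • v + β • w) ≤ m * (α^2 + β^2))) →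
      m < 1 / 8 := by
  intro m u t₀ x₀ ht₀ hu hGE _
  have hz : ∀ x, u t₀ x = 0 := fun x => by
    have h := hu.2.2.1 t₀ ht₀ x
    rw [zero_div] at h
    exact norm_le_zero_iff.1 h
  have hm : m ≤ 0 := nonpos_of_twoFrame_lower_of_slice_zero hz hGE
  linarith

/-- **The genuine crux is immune to the decoy**: no kinematic decoy with `a ≠ 0`, `δ > 0` belongs to
any `𝒦_C` — an element of `𝒦_C` with the decoy's lower two-frame value `m` at `(−1,0)` would need
`m ≤ K₀(C)`, but the decoys realise every `m` (so for `m > K₀(C)` membership fails); stated here in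
the form used by provers: an element of `𝒦_C` attaining value `m` at `(−1, 0)` has `m ≤ K₀(C)`. [folklore] -/
theorem lamGE_le_gauge (C : ℝ) : ∃ K₀ : ℝ, ∀ (m : ℝ) (u : ℝ → EuclideanSpace ℝ (Fin 3) → EuclideanSpace ℝ (Fin 3))
    (t₀ : ℝ) (x₀ : EuclideanSpace ℝ (Fin 3)), t₀ < 0 →
    (ContDiffOn ℝ (⊤ : ℕ∞) (Function.uncurry u) (Set.Iio 0 ×ˢ Set.univ) ∧ (∀ t < 0, Literature.Analysis.FluidPDE.VectorCalculus.IsDivFree (u t)) ∧ (∀ s t : ℝ, s < t → t < 0 → ∀ x, u t x = Literature.Analysis.FluidPDE.heatFlow (u s) (t-s) x - ∫ τ in Set.Ioo s t, ∫ y, ((-(inner ℝ (x-y) (u τ y) / (2*(t-τ)) * Literature.Analysis.UnboundedOperators.heatKernel (t-τ) (x-y))) • u τ y + (∫ σ in Set.Ioi (t-τ), Literature.Analysis.UnboundedOperators.heatKernel σ (x-y) / (4*σ^2)) • (inner ℝ (x-y) (u τ y) • u τ y + inner ℝ (u τ y) (u τ y) • (x-y) + inner ℝ (x-y) (u τ y)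 • u τ y) - ((∫ σ in Set.Ioi (t-τ), Literature.Analysis.UnboundedOperators.heatKernel σ (x-y) / (8*σ^3)) * (inner ℝ (x-y) (u τ y) * inner ℝ (x-y) (u τ y))) • (x-y))) ∧ Literature.Analysis.FluidPDE.HasTypeITimeDecay C u ∧ (∀ (x₀ : EuclideanSpace ℝ (Fin 3)) (t₀ r : ℝ), t₀ ≤ 0 → 0 < r → (∀ t, t₀ - r^2 < t → t < t₀ → r⁻¹ * ∫ x in Metric.ball x₀ r, ‖u t x‖^2 ≤ C) ∧ r⁻¹ * ∫ t in Set.Ioo (t₀ - r^2) t₀, ∫ x in Metric.ball x₀ r, ‖fderiv ℝ (u t) x‖^2 ≤ C)) →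
    (∃ v w : EuclideanSpace ℝ (Fin 3), ‖v‖ = 1 ∧ ‖w‖ = 1 ∧ inner ℝ v w = 0 ∧ ∀ α β : ℝ, m * (α^2 + β^2) ≤ (-t₀) * inner ℝ (fderiv ℝ (u t₀) x₀ (α • v + β • w)) (α • v + β • w)) → m ≤ K₀ := by
  obtain ⟨K₀, hK₀⟩ := exists_gauge_norm_fderiv_le_of_typeI C
  refine ⟨K₀, fun m u t₀ x₀ ht₀ hu hGE => ?_⟩
  obtain ⟨h1, h2, h3, h4, -⟩ := hu
  have hv : IsTypeIAncientMild C u := isTypeIAncientMild_of_squeezeClass h1 h2 h3 h4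
  obtain ⟨v, w, hv1, hw1, hvw, hαβ⟩ := hGE
  have h := hαβ 1 0
  have hz : ‖(1 : ℝ) • v + (0 : ℝ) • w‖ ^ 2 = 1 ^ 2 + 0 ^ 2 := norm_sq_smul_add_smul hv1 hw1 hvw 1 0
  set z : EuclideanSpace ℝ (Fin 3) := (1 : ℝ) • v + (0 : ℝ) • w with hzdef
  have hzn : ‖z‖ ^ 2 = 1 := by rw [hz]; norm_num
  have ht' : 0 ≤ -t₀ := by linarith
  have hin : inner ℝ (fderiv ℝ (u t₀) x₀ z) z ≤ ‖fderiv ℝ (u t₀) x₀‖ * ‖z‖ ^ 2 :=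
    calc inner ℝ (fderiv ℝ (u t₀) x₀ z) z ≤ ‖fderiv ℝ (u t₀) x₀ z‖ * ‖z‖ := real_inner_le_norm _ _
      _ ≤ ‖fderiv ℝ (u t₀) x₀‖ * ‖z‖ * ‖z‖ :=
          mul_le_mul_of_nonneg_right (ContinuousLinearMap.le_opNorm _ _) (norm_nonneg _)
      _ = ‖fderiv ℝ (u t₀) x₀‖ * ‖z‖ ^ 2 := by ring
  have key : m ≤ (-t₀) * ‖fderiv ℝ (u t₀) x₀‖ := by
    have h' : m * ((1 : ℝ) ^ 2 + 0 ^ 2) ≤ (-t₀) * (‖fderiv ℝ (u t₀) x₀‖ * ‖z‖ ^ 2) :=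
      h.trans (mul_le_mul_of_nonneg_left hin ht')
    rw [hzn] at h'
    linarith
  exact key.trans (hK₀ hv t₀ ht₀ x₀)

end Summit.NavierStokesRegularity.NavierStokesRegularity.Theorems.ExtremalBiaxialitySubcritical.Negative

end
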